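import Literature.Geometry.Riemannian.UpperVolumeBound
import Literature.Geometry.Riemannian.HeatKernelGaussianIntegralBound
import HarnessLib

/-!
# Volume of a time-slice of points with nearby `H_m`-centres
# (Bamler 2020a, §9, the core of the volume bound for time-slices of `P*`-parabolic neighbourhoods)

R. Bamler, *Entropy and heat kernel bounds on a Ricci flow background*, arXiv:2008.07093 (2020a),
§9 (arXiv v1 Thm. 35) bounds the volume of the time-slices `S_t` of a `P*`-parabolic neighbourhood
`P*(x₀,t₀; A r, −T⁻ r², T⁺ r²)`: `|S_t|_t ≤ C(A, T^±, α) exp(𝒩_{x₀,t₀}(T⁻ r²)) rⁿ`. The heart of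
its proof, displays (9.10)–(9.11) of the source with the `W₁`-bookkeeping stripped off, is the
following statement, proved here as `exists_riemVolume_le_of_hCenters_near`: for `m ≥ 3`,
`Λ, D ≥ 0`, `Θ > 0` there is `C = C(m, Λ, D, Θ) > 0` such that for a Ricci flow on `[a, T]` of a
smooth family of Riemannian metrics on a closed connected `m`-manifold, times
`a < s₁ < s₀ < t ≤ T` with `t − s₀ ≤ Θ (s₀ − s₁)`, `R ≥ R_min` on `M × [s₁, t]`,
`−R_min (t − s₁) ≤ Λ`, a point `z₀` and a measurable set `X` of points `x` each of which has an
`H_m`-centre `(z, s₀)` (`∫ d_{s₀}(z, ·)² dν_{x,t;s₀} ≤ H_m (t − s₀)`, `H_m = (m − 1)π²/2 + 4`) with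
`d_{s₀}(z₀, z) < D √(s₀ − s₁)`,

  `|X|_t ≤ C (s₀ − s₁)^{m/2} exp(𝒩*_{s₁}(z₀, s₀))`.

Proof (as in the source): with `ρ = √(s₀ − s₁)` and the ball `B = B_{s₀}(z₀, A ρ)`,
`A = max (D + √(2 H_m Θ)) 1`, every `x ∈ X` has `ν_{x,t;s₀}(B) ≥ 1/2` (concentration at an
`H_m`-centre, `measure_setOf_sqrt_lt_le_half`, and the triangle inequality:
`B ⊇ B_{s₀}(z, √(2 H_m (t − s₀)))`); by Tonelli and the forward mass bound (7.3)
(`integral_heatKernelFn_basePoint_le_exp`, in place of the heat flow of `χ_B` used in the source),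
`(1/2)|X|_t ≤ ∫_M ν_{x,t;s₀}(B) dg_t(x) = ∫_B ∫_M K(x,t;y,s₀) dg_t(x) dg_{s₀}(y) ≤ e^{Λ} |B|_{s₀}`
(`IsRicciFlow.lintegral_heatKernelMeasure_apply_le`), and Thm. 8.1
(`exists_riemVolume_ball_le_exp_pointedNashEntropy`) bounds `|B|_{s₀}` by
`C₈ e^{C₂ A²} (s₀ − s₁)^{m/2} e^{𝒩*_{s₁}(z₀, s₀)}`. Everything is proved; no definitions, no named
facts. What is NOT here: `H_m`-centres and `P*`-parabolic neighbourhoods as definitions, the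
`W₁`-estimates locating the centres (the hypothesis `d_{s₀}(z₀, z) < D ρ` is assumed), the bound
for the `A' r`-neighbourhood of `S_t`, and the covering theorem (arXiv v1 Thm. 36).

## References

* R. H. Bamler, *Entropy and heat kernel bounds on a Ricci flow background*, arXiv:2008.07093
  (2020), §9.1 (arXiv v1 Thm. 35) and its proof in §9.2, (9.10)–(9.11); §7.2, (7.3); §8,
  Thm. 8.1. [Bamler2020Entropy]
-/

noncomputable section

open Set Filter Function MeasureTheory Measure
open scoped Manifold ContDiff Topology ENNReal NNReal

namespace Literature.Geometry.Riemannian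

open Lorentzian Lorentzian.PseudoRiemannianMetric MetricFlow

/-! ### Tonelli and the forward mass bound: `∫_M ν_{x,t;s}(B) dg_t(x) ≤ e^{−R_min (t−s)} |B|_s` -/

section Mass

variable {m : ℕ} {H : Type*} [TopologicalSpace H]
  {I : ModelWithCorners ℝ (EuclideanSpace ℝ (Fin m)) H} [I.Boundaryless]
  {M : Type*} [TopologicalSpace M] [ChartedSpace H M] [IsManifold I ∞ M]
  [T2Space M] [CompactSpace M] [SecondCountableTopology M] [MeasurableSpace M] [BorelSpace M]
  [PreconnectedSpace M]
  {h : ℝ → PseudoRiemannianMetric I ∞ (EuclideanSpace ℝ (Fin m)) (TangentSpace I : M → Type _)}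
  {cov : ℝ → CovariantDerivative I (EuclideanSpace ℝ (Fin m)) (TangentSpace I : M → Type _)}
  {a T : ℝ}

/-- **The integrated mass of a fixed set under the conjugate heat kernel measures** (Bamler 2020a,
§9.2, proof of arXiv v1 Thm. 35, display (9.11): "`(1/2)|S|_t ≤ ∫_M u(·, t) dg_t ≤ e^{…} |B|_0`"):
for a Ricci flow `(h, cov)` on `[a, T]` of a `C^∞` family of Riemannian metrics on a closed
connected manifold, `a < s < t ≤ T`, `R ≥ R_min` on `M × [s, t]` and a measurable `B ⊆ M`,

  `∫_M ν_{x,t;s}(B) dg_t(x) ≤ e^{−R_min (t − s)} |B|_s`.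

Proof: `ν_{x,t;s}(B) = ∫_B K(x,t;y,s) dg_s(y)` (`heatKernelMeasure_eq_withDensity_heatKernelFn`),
Tonelli (`K(·,t;·,s)` is jointly continuous), and the forward mass bound (7.3)
`∫_M K(x,t;y,s) dg_t(x) ≤ e^{−R_min (t−s)}` (`integral_heatKernelFn_basePoint_le_exp`).
[cite: Bamler2020Entropy, §9.2, proof of arXiv v1 Thm. 35, (9.11); §7.2, (7.3)] -/
theorem IsRicciFlow.lintegral_heatKernelMeasure_apply_le (hflow : IsRicciFlow h cov (Icc a T))
    (hh : IsContMDiffFamilyOn ∞ h univ) (hR : ∀ r, (h r).IsRiemannian) {s t : ℝ} (has : a < s)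
    (hst : s < t) (htT : t ≤ T) {Rmin : ℝ}
    (hRmin : ∀ r ∈ Icc s t, ∀ z : M, Rmin ≤ (h r).scalarCurvatureWith (cov r) z)
    {B : Set M} (hB : MeasurableSet B) :
    ∫⁻ x, heatKernelMeasure hh hR t x s B ∂(h t).riemVolume ≤
      ENNReal.ofReal (Real.exp (-Rmin * (t - s))) * (h s).riemVolume B := by
  have ht : t ∈ Ioc a T := ⟨has.trans hst, htT⟩
  have hs : s ∈ Ioo a t := ⟨has, hst⟩
  haveI : IsFiniteMeasure (h t).riemVolume := ⟨(h t).riemVolume_univ_lt_top⟩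
  haveI : IsFiniteMeasure (h s).riemVolume := ⟨(h s).riemVolume_univ_lt_top⟩
  -- joint continuity of `K(·,t;·,s)` on `M × M`
  have hK2 : Continuous fun p : M × M ↦ hflow.heatKernelFn hh hR t p.1 (p.2, s) :=
    (hflow.continuousOn_heatKernelFn hh hR ht).comp_continuous
      (continuous_fst.prodMk (continuous_snd.prodMk continuous_const))
      fun p ↦ ⟨mem_univ _, mem_univ _, hs⟩
  set f : M → M → ℝ≥0∞ := fun x y ↦ ENNReal.ofReal (hflow.heatKernelFn hh hR t x (y, s)) with hf
  have hfm : Measurable (uncurry f) := by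
    rw [Function.uncurry_def]
    exact hK2.measurable.ennreal_ofReal
  -- `ν_{x,t;s}(B) = ∫_B K(x,t;y,s) dg_s(y)`
  have h1 : ∀ x, heatKernelMeasure hh hR t x s B = ∫⁻ y in B, f x y ∂(h s).riemVolume := fun x ↦ by
    rw [hflow.heatKernelMeasure_eq_withDensity_heatKernelFn hh hR ht x hs, withDensity_apply _ hB]
  -- the forward mass bound (7.3), in `ℝ≥0∞`
  have hinner : ∀ y, ∫⁻ x, f x y ∂(h t).riemVolume ≤
      ENNReal.ofReal (Real.exp (-Rmin * (t - s))) := by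
    intro y
    have hc : Continuous fun x ↦ hflow.heatKernelFn hh hR t x (y, s) :=
      hK2.comp (continuous_id.prodMk continuous_const : Continuous fun x : M ↦ (x, y))
    have hi : Integrable (fun x ↦ hflow.heatKernelFn hh hR t x (y, s)) (h t).riemVolume :=
      (h t).integrable_of_continuous hc
    have hnn : 0 ≤ᵐ[(h t).riemVolume] fun x ↦ hflow.heatKernelFn hh hR t x (y, s) :=
      Eventually.of_forall fun x ↦ (hflow.heatKernelFn_pos hh hR ht x ⟨mem_univ _, hs⟩).le
    have e : ∫⁻ x, f x y ∂(h t).riemVolume =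
        ENNReal.ofReal (∫ x, hflow.heatKernelFn hh hR t x (y, s) ∂(h t).riemVolume) := by
      rw [ofReal_integral_eq_lintegral_ofReal hi hnn]
    rw [e]
    exact ENNReal.ofReal_le_ofReal
      (integral_heatKernelFn_basePoint_le_exp hflow hh hR has hst htT hRmin y)
  calc ∫⁻ x, heatKernelMeasure hh hR t x s B ∂(h t).riemVolume
      = ∫⁻ x, ∫⁻ y in B, f x y ∂(h s).riemVolume ∂(h t).riemVolume := lintegral_congr h1
    _ = ∫⁻ y in B, ∫⁻ x, f x y ∂(h t).riemVolume ∂(h s).riemVolume :=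
        lintegral_lintegral_swap hfm.aemeasurable
    _ ≤ ∫⁻ _ in B, ENNReal.ofReal (Real.exp (-Rmin * (t - s))) ∂(h s).riemVolume :=
        lintegral_mono fun y ↦ hinner y
    _ = ENNReal.ofReal (Real.exp (-Rmin * (t - s))) * (h s).riemVolume B := setLIntegral_const _ _

end Mass

/-! ### The volume bound -/

/-- **Bamler 2020a, §9 (arXiv v1 Thm. 35), core of the volume bound for time-slices of
`P*`-parabolic neighbourhoods.** For `m ≥ 3`, `Λ ≥ 0`, `D ≥ 0`, `Θ > 0` there is `C > 0` such that
for every Ricci flow `hflow` on `[a, T]` of a smooth family of Riemannian metrics on a closed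
connected manifold modelled on `ℝᵐ`, all `a < s₁ < s₀ < t ≤ T` with `t − s₀ ≤ Θ (s₀ − s₁)`,
`R ≥ R_min` on `M × [s₁, t]`, `−R_min (t − s₁) ≤ Λ`, every `z₀ ∈ M` and every measurable set `X`
of points `x` each of which has an `H_m`-centre `(z, s₀)`,
`∫ d_{s₀}(z, ·)² dν_{x,t;s₀} ≤ H_m (t − s₀)`, `H_m = (m − 1)π²/2 + 4`, with
`d_{s₀}(z₀, z) < D √(s₀ − s₁)`:

  `|X|_{g_t} ≤ C (s₀ − s₁)^{m/2} exp(𝒩*_{s₁}(z₀, s₀))`.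

Proof ((9.10)–(9.11) of the source): for `B = B_{s₀}(z₀, A√(s₀ − s₁))`,
`A = max (D + √(2 H_m Θ)) 1`, each `x ∈ X` has `ν_{x,t;s₀}(B) ≥ ν_{x,t;s₀}(B_{s₀}(z, √(2H_m(t−s₀))))
≥ 1/2` (`measure_setOf_sqrt_lt_le_half`), so `(1/2)|X|_t ≤ ∫_M ν_{x,t;s₀}(B) dg_t ≤ e^{Λ} |B|_{s₀}`
(`IsRicciFlow.lintegral_heatKernelMeasure_apply_le`), and `|B|_{s₀} ≤ C₈ e^{C₂A²} (s₀−s₁)^{m/2}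
e^{𝒩*_{s₁}(z₀,s₀)}` by Thm. 8.1 (`exists_riemVolume_ball_le_exp_pointedNashEntropy`).
[cite: Bamler2020Entropy, §9, arXiv v1 Thm. 35, (9.10)–(9.11)] -/
theorem exists_riemVolume_le_of_hCenters_near (m : ℕ) (hm : 3 ≤ m) {Λ D Θ : ℝ} (hΛ : 0 ≤ Λ)
    (_hD : 0 ≤ D) (hΘ : 0 < Θ) :
    ∃ C : ℝ, 0 < C ∧ ∀ {M : Type*} [TopologicalSpace M]
      [ChartedSpace (EuclideanSpace ℝ (Fin m)) M]
      [IsManifold 𝓘(ℝ, EuclideanSpace ℝ (Fin m)) ∞ M] [T2Space M] [CompactSpace M]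
      [SecondCountableTopology M] [MeasurableSpace M] [BorelSpace M] [ConnectedSpace M] [T3Space M]
      {h : ℝ → PseudoRiemannianMetric 𝓘(ℝ, EuclideanSpace ℝ (Fin m)) ∞ (EuclideanSpace ℝ (Fin m))
        (TangentSpace 𝓘(ℝ, EuclideanSpace ℝ (Fin m)) : M → Type _)}
      {cov : ℝ → CovariantDerivative 𝓘(ℝ, EuclideanSpace ℝ (Fin m)) (EuclideanSpace ℝ (Fin m))
        (TangentSpace 𝓘(ℝ, EuclideanSpace ℝ (Fin m)) : M → Type _)}
      {a T : ℝ} (hflow : IsRicciFlow h cov (Icc a T)) (hh : IsContMDiffFamilyOn ∞ h univ)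
      (hR : ∀ r, (h r).IsRiemannian),
      ∀ {s₁ s₀ t : ℝ}, a < s₁ → s₁ < s₀ → s₀ < t → t ≤ T → t - s₀ ≤ Θ * (s₀ - s₁) →
      ∀ {Rmin : ℝ}, (∀ r ∈ Icc s₁ t, ∀ z : M, Rmin ≤ (h r).scalarCurvatureWith (cov r) z) →
      -Rmin * (t - s₁) ≤ Λ → ∀ (z₀ : M) {X : Set M}, MeasurableSet X →
      (∀ x ∈ X, ∃ z : M,
        ∫⁻ w, (h s₀).edist (hR s₀) z w ^ 2 ∂(heatKernelMeasure hh hR t x s₀) ≤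
          ENNReal.ofReal ((((m : ℝ) - 1) * Real.pi ^ 2 / 2 + 4) * (t - s₀)) ∧
        (h s₀).edist (hR s₀) z₀ z < ENNReal.ofReal (D * Real.sqrt (s₀ - s₁))) →
      (h t).riemVolume.real X ≤
        C * (s₀ - s₁) ^ ((m : ℝ) / 2) *
          Real.exp (pointedNashEntropy h (fun r v ↦ hflow.heatKernelFn hh hR s₀ z₀ (v, r)) m s₀ s₁) := by
  classical
  obtain ⟨C₈, C₂, hC₈, hC₂, H81⟩ := exists_riemVolume_ball_le_exp_pointedNashEntropy m hm hΛ
  set Hm : ℝ := ((m : ℝ) - 1) * Real.pi ^ 2 / 2 + 4 with hHm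
  have hHm0 : 0 ≤ Hm := by
    have h3 : (3 : ℝ) ≤ m := by exact_mod_cast hm
    have h1 : 0 ≤ ((m : ℝ) - 1) * Real.pi ^ 2 / 2 :=
      div_nonneg (mul_nonneg (by linarith only [h3]) (sq_nonneg _)) zero_le_two
    rw [hHm]; linarith only [h1]
  set A : ℝ := max (D + Real.sqrt (2 * Hm * Θ)) 1 with hA
  have hA1 : 1 ≤ A := le_max_right _ _
  have hAD : D + Real.sqrt (2 * Hm * Θ) ≤ A := le_max_left _ _
  refine ⟨2 * Real.exp Λ * (C₈ * Real.exp (C₂ * A ^ 2)), by positivity, ?_⟩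
  intro M _ _ _ _ _ _ _ _ _ _ h cov a T hflow hh hR s₁ s₀ t has₁ hs₁₀ hs₀t htT hΘt Rmin hRmin hRΛ
    z₀ X hX hcen
  have hρ0 : 0 < Real.sqrt (s₀ - s₁) := Real.sqrt_pos.2 (sub_pos.2 hs₁₀)
  have hτ : 0 < t - s₀ := sub_pos.2 hs₀t
  have has₀ : a < s₀ := has₁.trans hs₁₀
  -- the two scalar curvature budgets
  have hRΛ₀ : -Rmin * (t - s₀) ≤ Λ := by
    rcases le_or_gt 0 Rmin with h0 | h0
    · have h1 : 0 ≤ Rmin * (t - s₀) := mul_nonneg h0 hτ.le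
      linarith only [h1, hΛ]
    · have h1 : -Rmin * (t - s₀) ≤ -Rmin * (t - s₁) :=
        mul_le_mul_of_nonneg_left (by linarith only [hs₁₀]) (by linarith only [h0])
      exact h1.trans hRΛ
  have hRΛ₁ : -Rmin * (s₀ - s₁) ≤ Λ := by
    rcases le_or_gt 0 Rmin with h0 | h0
    · have h1 : 0 ≤ Rmin * (s₀ - s₁) := mul_nonneg h0 (sub_pos.2 hs₁₀).le
      linarith only [h1, hΛ]
    · have h1 : -Rmin * (s₀ - s₁) ≤ -Rmin * (t - s₁) :=
        mul_le_mul_of_nonneg_left (by linarith only [hs₀t]) (by linarith only [h0])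
      exact h1.trans hRΛ
  -- the ball `B = B_{s₀}(z₀, A ρ)` and its volume (Thm. 8.1)
  set N : ℝ := pointedNashEntropy h (fun r v ↦ hflow.heatKernelFn hh hR s₀ z₀ (v, r)) m s₀ s₁
    with hN
  set B : Set M := {y | (h s₀).edist (hR s₀) z₀ y < ENNReal.ofReal (A * Real.sqrt (s₀ - s₁))}
    with hB
  have hdc₀ : Continuous fun y ↦ (h s₀).edist (hR s₀) z₀ y :=
    ((h s₀).continuous_edist (hR s₀)).comp (.prodMk_right z₀)
  have hBm : MeasurableSet B := measurableSet_lt hdc₀.measurable measurable_const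
  set Q : ℝ := C₈ * Real.exp (C₂ * A ^ 2) * (s₀ - s₁) ^ ((m : ℝ) / 2) * Real.exp N with hQ
  have hQ0 : 0 ≤ Q := by positivity
  have hvolB : (h s₀).riemVolume B ≤ ENNReal.ofReal Q :=
    H81 hflow hh hR has₁ hs₁₀ (hs₀t.trans_le htT)
      (fun r hr z ↦ hRmin r ⟨hr.1, hr.2.trans hs₀t.le⟩ z) hRΛ₁ z₀ hA1
  -- concentration: `ν_{x,t;s₀}(B) ≥ 1/2` for `x ∈ X`
  have hhalf : ∀ x ∈ X, (2⁻¹ : ℝ≥0∞) ≤ heatKernelMeasure hh hR t x s₀ B := by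
    intro x hx
    obtain ⟨z, hz, hzz⟩ := hcen x hx
    have hdc : Continuous fun w ↦ (h s₀).edist (hR s₀) z w :=
      ((h s₀).continuous_edist (hR s₀)).comp (.prodMk_right z)
    set r₁ : ℝ := Real.sqrt (2 * (Hm * (t - s₀))) with hr₁
    have hr₁0 : 0 ≤ r₁ := Real.sqrt_nonneg _
    set S : Set M := {w | ENNReal.ofReal r₁ < (h s₀).edist (hR s₀) z w} with hS
    have hSm : MeasurableSet S := measurableSet_lt measurable_const hdc.measurable
    have hconc : heatKernelMeasure hh hR t x s₀ S ≤ 2⁻¹ :=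
      measure_setOf_sqrt_lt_le_half _ hdc hz
    -- `Bᶜ ⊆ S` by the triangle inequality
    have hcompl : Bᶜ ⊆ S := by
      intro w hw
      simp only [hB, mem_compl_iff, mem_setOf_eq, not_lt] at hw
      rw [hS, mem_setOf_eq]
      have hfin₁ : (h s₀).edist (hR s₀) z₀ z ≠ ⊤ := PseudoRiemannianMetric.edist_ne_top (hR s₀) _ _
      have hfin₂ : (h s₀).edist (hR s₀) z w ≠ ⊤ := PseudoRiemannianMetric.edist_ne_top (hR s₀) _ _
      have hfin₃ : (h s₀).edist (hR s₀) z₀ w ≠ ⊤ := PseudoRiemannianMetric.edist_ne_top (hR s₀) _ _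
      have htri : (h s₀).edist (hR s₀) z₀ w ≤ (h s₀).edist (hR s₀) z₀ z + (h s₀).edist (hR s₀) z w :=
        PseudoRiemannianMetric.edist_triangle (hR s₀) z₀ z w
      have htri' := ENNReal.toReal_mono (ENNReal.add_ne_top.2 ⟨hfin₁, hfin₂⟩) htri
      rw [ENNReal.toReal_add hfin₁ hfin₂] at htri'
      have hw' : A * Real.sqrt (s₀ - s₁) ≤ ((h s₀).edist (hR s₀) z₀ w).toReal :=
        (ENNReal.ofReal_le_iff_le_toReal hfin₃).1 hw
      have hzz' : ((h s₀).edist (hR s₀) z₀ z).toReal < D * Real.sqrt (s₀ - s₁) :=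
        ENNReal.toReal_lt_of_lt_ofReal hzz
      -- `r₁ ≤ √(2 H_m Θ) ρ ≤ (A - D) ρ`
      have h2 : 2 * (Hm * (t - s₀)) ≤ 2 * Hm * Θ * (s₀ - s₁) := by
        have := mul_le_mul_of_nonneg_left hΘt (by positivity : (0 : ℝ) ≤ 2 * Hm)
        linarith only [this]
      have hr₁le : r₁ ≤ Real.sqrt (2 * Hm * Θ) * Real.sqrt (s₀ - s₁) := by
        rw [← Real.sqrt_mul (by positivity : (0 : ℝ) ≤ 2 * Hm * Θ)]
        exact Real.sqrt_le_sqrt h2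
      have hAρ : Real.sqrt (2 * Hm * Θ) * Real.sqrt (s₀ - s₁) ≤
          A * Real.sqrt (s₀ - s₁) - D * Real.sqrt (s₀ - s₁) := by
        rw [← sub_mul]
        exact mul_le_mul_of_nonneg_right (by linarith only [hAD]) hρ0.le
      refine (ENNReal.ofReal_lt_iff_lt_toReal hr₁0 hfin₂).2 ?_
      linarith only [htri', hw', hzz', hr₁le, hAρ]
    calc (2⁻¹ : ℝ≥0∞) = 1 - 2⁻¹ := ENNReal.one_sub_inv_two.symm
      _ ≤ 1 - heatKernelMeasure hh hR t x s₀ S := tsub_le_tsub_left hconc 1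
      _ = heatKernelMeasure hh hR t x s₀ Sᶜ := (prob_compl_eq_one_sub hSm).symm
      _ ≤ heatKernelMeasure hh hR t x s₀ B := measure_mono (compl_subset_comm.1 hcompl)
  -- `(1/2)|X|_t ≤ ∫_M ν_{x,t;s₀}(B) dg_t ≤ e^{Λ} |B|_{s₀} ≤ e^{Λ} Q`
  have hchain : (2⁻¹ : ℝ≥0∞) * (h t).riemVolume X ≤
      ENNReal.ofReal (Real.exp Λ) * ENNReal.ofReal Q := by
    calc (2⁻¹ : ℝ≥0∞) * (h t).riemVolume X
        = ∫⁻ _ in X, (2⁻¹ : ℝ≥0∞) ∂(h t).riemVolume := (setLIntegral_const _ _).symm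
      _ ≤ ∫⁻ x in X, heatKernelMeasure hh hR t x s₀ B ∂(h t).riemVolume :=
          setLIntegral_mono' hX hhalf
      _ ≤ ∫⁻ x, heatKernelMeasure hh hR t x s₀ B ∂(h t).riemVolume := setLIntegral_le_lintegral _ _
      _ ≤ ENNReal.ofReal (Real.exp (-Rmin * (t - s₀))) * (h s₀).riemVolume B :=
          hflow.lintegral_heatKernelMeasure_apply_le hh hR has₀ hs₀t htT
            (fun r hr z ↦ hRmin r ⟨hs₁₀.le.trans hr.1, hr.2⟩ z) hBm
      _ ≤ ENNReal.ofReal (Real.exp Λ) * ENNReal.ofReal Q :=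
          mul_le_mul' (ENNReal.ofReal_le_ofReal (Real.exp_le_exp.2 hRΛ₀)) hvolB
  have hV : (h t).riemVolume X ≤ ENNReal.ofReal (2 * (Real.exp Λ * Q)) := by
    have e : ENNReal.ofReal (2 * (Real.exp Λ * Q)) =
        2 * (ENNReal.ofReal (Real.exp Λ) * ENNReal.ofReal Q) := by
      rw [ENNReal.ofReal_mul zero_le_two, ENNReal.ofReal_ofNat,
        ENNReal.ofReal_mul (Real.exp_pos _).le]
    calc (h t).riemVolume X = 2 * (2⁻¹ * (h t).riemVolume X) := by
          rw [← mul_assoc, ENNReal.mul_inv_cancel two_ne_zero ENNReal.ofNat_ne_top, one_mul]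
      _ ≤ 2 * (ENNReal.ofReal (Real.exp Λ) * ENNReal.ofReal Q) := mul_le_mul' le_rfl hchain
      _ = _ := e.symm
  rw [measureReal_def]
  calc ((h t).riemVolume X).toReal ≤ (ENNReal.ofReal (2 * (Real.exp Λ * Q))).toReal :=
        ENNReal.toReal_mono ENNReal.ofReal_ne_top hV
    _ = 2 * (Real.exp Λ * Q) := ENNReal.toReal_ofReal (by positivity)
    _ = 2 * Real.exp Λ * (C₈ * Real.exp (C₂ * A ^ 2)) * (s₀ - s₁) ^ ((m : ℝ) / 2) * Real.exp N := by
        rw [hQ]; ring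

end Literature.Geometry.Riemannian

end
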